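import Summits.BirchSwinnertonDyer.BirchSwinnertonDyer.Theorems.ManinLocalTwoThreePShiftDescentEngine
import HarnessLib

/-!
# The prime-generic descent engine, II: extension from `G₁` to `Γ₀(pm)` along the diagonal subgroup — the `K_{p,p}` step modulo ONE equation
# (route `ManinLocalTwoThree`, cell bsd-f2-manin; cruxes C2 stmt-BirchSwinnertonDyer-22967 / C3 stmt-…-22968; LEAD seat p1 gen 12; the `p ∣ N`
# steps of the LEAD's prime-generic shift-equaliser conjecture = typer's `ShiftEqualiser.PrimeShiftInvariantIsDiamond`)

File I (`…PShiftDescentEngine.lean`) glues the pair (`coshift φ ε` on `A₁`, `restr φ` on `B = Γ₀(p²m)`) to `W` additive on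
`G₁ = {a² ≡ 1 (mod p)} ≤ Γ₀(pm)` under the single equation `φ(P_{2/p}) = φ(P_{1/p})`.  Here `W` is extended to all of `G = Γ₀(pm)` along the
DIAGONAL subgroup `D = {p ∣ b, p²m ∣ c}` (`= A ∩ B`, on which `coshift = restr`): `G = D·G₁` (every unit class mod `p` is the top-left entry of an
element of `D`, `exists_mem_subD`), `W` is invariant under `D`-conjugation (uniqueness of the glued function on `G₁ = A₁·(B ∩ G₁)`), so
`PShiftGlue.glueExtend` gives `w` additive on `G` with `w = coshift φ ε` on `A = {p ∣ b}` and `w = restr φ` on `B` — i.e. `w` is an `ε`-eigenfunction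
of the `p`-shift restricting to `φ`.  Main result **`descent`**: for every prime `p`, every `m ≥ 1`, every commutative ring `K` and every `ε`,
an additive `φ : Γ₀(p²m) → K` with `IsShiftEigenP p ε φ` and `φ(P_{2/p}) = φ(P_{1/p})` is the restriction of an additive `ε`-eigenfunction on
`Γ₀(pm)`.  (The equation is then discharged by a conductor-`p²` diamond certificate at `p ∤ m` and by p2's Heisenberg lift at `p ∣ m` — sibling
files.)  Nothing about BSD, Manin's conjecture or C2/C3 is asserted here. [cite: DarmonDiamondTaylor1995, Lemma 4.28 (p. 135) (shape only)]
-/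

set_option autoImplicit false
set_option linter.dupNamespace false

open scoped MatrixGroups

open CongruenceSubgroup Matrix.SpecialLinearGroup
  Summit.BirchSwinnertonDyer.Rank1Residual.ManinAdditive.NineShiftEqualiser

namespace Summit.BirchSwinnertonDyer.BirchSwinnertonDyer.Theorems.ManinLocalTwoThree

namespace PShiftEngine

open ThreeShiftDescent TwoShift PShiftTransfer PShiftGlue

variable {p : ℕ} [Fact p.Prime]

/-! ### §1. The diagonal subgroup `D` and `G = D·G₁` -/

section Diagonal

variable (p) (m : ℕ)

/-- **`D = {γ ∈ Γ₀(pm) : p ∣ b, p²m ∣ c}` = `A ∩ B`**. [folklore] -/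
def subD : Subgroup (Gamma0 (p * m)) := stabZero p (p * m) ⊓ subB p m

variable {p m}

/-- Membership in `D`. [folklore] -/
theorem mem_subD {γ : Gamma0 (p * m)} : γ ∈ subD p m ↔ γ ∈ stabZero p (p * m) ∧ γ ∈ subB p m := Subgroup.mem_inf

/-- **`G₁` is normal in `Γ₀(pm)`** (conjugation fixes `a mod p`). [folklore] -/
theorem subG1_normal : (subG1 p m).Normal := by
  refine ⟨fun x hx g => ?_⟩
  have hpL := p_dvd_level p m
  rw [mem_subG1] at hx ⊢
  obtain ⟨i00, -, -⟩ := ent_inv (p := p) g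
  rw [ent00_mul hpL, ent00_mul hpL, i00, mul_right_comm, ent_det hpL g, one_mul, hx]

/-- **Every unit class mod `p` is the top-left entry of an element of `D`** (`m ≥ 1`): with `x ≡ a (mod p)`, `x ≡ 1 (mod m′)` (`m = pᵉ m′`,
`p ∤ m′`) and `u x + v p³m = 1`, the matrix `(x, −pv; p²m, u)`. [folklore] -/
theorem exists_mem_subD (hm : 0 < m) (a : ZMod p) (ha : a ≠ 0) :
    ∃ d ∈ subD p m, ent (p := p) ((d : Gamma0 (p * m)) : SL(2, ℤ)) 0 0 = a := by
  have hp : p.Prime := Fact.out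
  obtain ⟨e, m', hm', hme⟩ := Nat.exists_eq_pow_mul_and_not_dvd hm.ne' p hp.one_lt.ne'
  have hcop : Nat.Coprime p m' := (Nat.Prime.coprime_iff_not_dvd hp).mpr hm'
  obtain ⟨x, hxp, hxm⟩ := Nat.chineseRemainder hcop a.val 1
  -- `x` is prime to `p` and to `m'`
  have hav : ¬ p ∣ a.val := fun h => by
    have h0 : a.val = 0 := Nat.eq_zero_of_dvd_of_lt h (ZMod.val_lt a)
    exact ha ((ZMod.val_eq_zero a).mp h0)
  have hxp' : Nat.Coprime x p := by
    rw [Nat.Coprime, hxp.gcd_eq]; exact (Nat.coprime_comm.mp ((Nat.Prime.coprime_iff_not_dvd hp).mpr hav))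
  have hxm'' : Nat.Coprime x m' := by
    rw [Nat.Coprime, hxm.gcd_eq, Nat.gcd_one_left]
  have hX : IsCoprime (x : ℤ) ((p : ℤ) * (p * (p * m))) := by
    have h1 : IsCoprime (x : ℤ) (p : ℤ) := Nat.isCoprime_iff_coprime.mpr hxp'
    have h2 : IsCoprime (x : ℤ) (m' : ℤ) := Nat.isCoprime_iff_coprime.mpr hxm''
    have e3 : ((p : ℤ) * (p * (p * m))) = (p : ℤ) ^ (e + 3) * m' := by rw [hme]; push_cast; ring
    rw [e3]
    exact (h1.pow_right).mul_right h2
  obtain ⟨u, v, huv⟩ := hX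
  refine ⟨g0Of x (-(p * v)) (p * (p * m)) u (by linear_combination huv) ⟨p, by push_cast; ring⟩, ?_, ?_⟩
  · rw [mem_subD]
    exact ⟨g0Of_mem_stabZero x (-v) _ u (by linear_combination huv) _ |> fun h => by
        simpa [show (p : ℤ) * -v = -(p * v) by ring] using h,
      g0Of_mem_subB _ _ _ _ _ _ ⟨1, by push_cast; ring⟩⟩
  · show (((x : ℤ)) : ZMod p) = a
    rw [Int.cast_natCast, (ZMod.natCast_eq_natCast_iff x a.val p).mpr hxp, ZMod.natCast_zmod_val]

/-- **`G = D·G₁`**: every `g ∈ Γ₀(pm)` is `d·x` with `d ∈ D`, `x ∈ G₁` (`m ≥ 1`). [folklore] -/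
theorem exists_subD_mul_subG1 (hm : 0 < m) (g : Gamma0 (p * m)) :
    ∃ d x : Gamma0 (p * m), d ∈ subD p m ∧ x ∈ subG1 p m ∧ g = d * x := by
  have hpL := p_dvd_level p m
  have hg := ent_det hpL g
  have ha : ent (p := p) (g : SL(2, ℤ)) 0 0 ≠ 0 := fun h => by rw [h, zero_mul] at hg; exact zero_ne_one hg
  obtain ⟨d, hd, hd00⟩ := exists_mem_subD hm _ ha
  refine ⟨d, d⁻¹ * g, hd, ?_, by group⟩
  rw [mem_subG1, ent00_mul hpL, (ent_inv d).1]
  have hdd := ent_det hpL d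
  rw [hd00] at hdd
  calc (ent (p := p) (d : SL(2, ℤ)) 1 1 * ent (g : SL(2, ℤ)) 0 0) ^ 2
      = (ent (g : SL(2, ℤ)) 0 0 * ent (d : SL(2, ℤ)) 1 1) ^ 2 := by ring
    _ = 1 := by rw [hdd, one_pow]

end Diagonal

/-! ### §2. `D`-invariance of the glued function and the extension -/

section Extend

variable {K : Type*} [CommRing K] {m : ℕ} (φ : Gamma0 (p * (p * m)) → K) (ε : K)

/-- The glued function of file I: `W(g) = coshift φ ε (g T^{−a_g b_g}) + (a_g b_g)·restr φ (T)`. [folklore] -/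
noncomputable def Wfun (g : Gamma0 (p * m)) : K :=
  coshift φ ε (g * Tpow (p * m) 1 ^ (-(((g : SL(2, ℤ)) 0 0 : ℤ) * (g : SL(2, ℤ)) 0 1)))
    + (((g : SL(2, ℤ)) 0 0 : ℤ) * (g : SL(2, ℤ)) 0 1) • restr φ (Tpow (p * m) 1)

/-- File I's `descentOn`, restated for `Wfun`. [folklore] -/
theorem Wfun_spec (hadd : IsAdd φ) (hinv : IsShiftEigenP p ε φ) (hP : φ (P2p p m) = φ (P1p p m)) :
    (∀ g ∈ subG1 p m, ∀ h ∈ subG1 p m, Wfun φ ε (g * h) = Wfun φ ε g + Wfun φ ε h) ∧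
    (∀ a ∈ subA1 p m, Wfun φ ε a = coshift φ ε a) ∧
    (∀ b ∈ subB p m, b ∈ subG1 p m → Wfun φ ε b = restr φ b) :=
  descentOn φ ε hadd hinv hP

/-- **Uniqueness on `G₁`**: an additive function on `G₁` vanishing on `A₁` and on `B ∩ G₁` vanishes on `G₁ = A₁·⟨T⟩`. [folklore] -/
theorem eq_zero_on_subG1 {u : Gamma0 (p * m) → K} (hu : ∀ g ∈ subG1 p m, ∀ h ∈ subG1 p m, u (g * h) = u g + u h)
    (hA : ∀ a ∈ subA1 p m, u a = 0) (hB : ∀ b ∈ subB p m, b ∈ subG1 p m → u b = 0) :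
    ∀ g ∈ subG1 p m, u g = 0 := by
  intro g hg
  set n : ℤ := ((g : SL(2, ℤ)) 0 0 : ℤ) * (g : SL(2, ℤ)) 0 1 with hn
  have h1 : g * Tpow (p * m) 1 ^ (-n) ∈ subA1 p m := mul_Tpow_neg_mem_subA1 g hg
  have h2 : Tpow (p * m) 1 ^ n ∈ subG1 p m := (subG1 p m).zpow_mem (Tpow_mem_subG1 1) n
  have e : g = (g * Tpow (p * m) 1 ^ (-n)) * Tpow (p * m) 1 ^ n := by rw [mul_assoc, ← zpow_add, neg_add_cancel, zpow_zero, mul_one]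
  rw [e, hu _ h1.1 _ h2, hA _ h1, hB _ ((subB p m).zpow_mem (Tpow_mem_subB 1) n) h2, add_zero]

/-- **`D`-invariance of `W` on `G₁`.** [folklore] -/
theorem Wfun_conj (hadd : IsAdd φ) (hinv : IsShiftEigenP p ε φ) (hP : φ (P2p p m) = φ (P1p p m)) :
    ∀ d ∈ subD p m, ∀ x ∈ subG1 p m, Wfun φ ε (d * x * d⁻¹) = Wfun φ ε x := by
  intro d hd x hx
  obtain ⟨hW, hWA, hWB⟩ := Wfun_spec φ ε hadd hinv hP
  have hGn := subG1_normal (p := p) (m := m)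
  have hAn := subA1_normal (p := p) (m := m)
  obtain ⟨hd0, hdB⟩ := mem_subD.mp hd
  have hcoA := coshift_add φ ε hadd (M := p * m)
  have hreB := restr_add_subB (p := p) (m := m) φ hadd
  -- the difference `u(x) = W(d x d⁻¹) − W(x)` is additive on `G₁` and vanishes on `A₁` and on `B ∩ G₁`
  have key := eq_zero_on_subG1 (u := fun y => Wfun φ ε (d * y * d⁻¹) - Wfun φ ε y)
    (fun g hg h hh => by
      show Wfun φ ε (d * (g * h) * d⁻¹) - Wfun φ ε (g * h) =
        (Wfun φ ε (d * g * d⁻¹) - Wfun φ ε g) + (Wfun φ ε (d * h * d⁻¹) - Wfun φ ε h)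
      have e : d * (g * h) * d⁻¹ = (d * g * d⁻¹) * (d * h * d⁻¹) := by group
      rw [e, hW _ (hGn.conj_mem g hg d) _ (hGn.conj_mem h hh d), hW _ hg _ hh]
      ring)
    (fun a ha => by
      show Wfun φ ε (d * a * d⁻¹) - Wfun φ ε a = 0
      rw [hWA _ (hAn.conj_mem a ha d), hWA _ ha,
        hcoA _ ((stabZero p (p * m)).mul_mem hd0 (stabZero_of_subA1 ha)) _ ((stabZero p (p * m)).inv_mem hd0),
        hcoA _ hd0 _ (stabZero_of_subA1 ha), addOn_map_inv hcoA hd0]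
      ring)
    (fun b hb hbG => by
      show Wfun φ ε (d * b * d⁻¹) - Wfun φ ε b = 0
      have hbdB : d * b * d⁻¹ ∈ subB p m := (subB p m).mul_mem ((subB p m).mul_mem hdB hb) ((subB p m).inv_mem hdB)
      rw [hWB _ hbdB (hGn.conj_mem b hbG d), hWB _ hb hbG, hreB _ ((subB p m).mul_mem hdB hb) _ ((subB p m).inv_mem hdB),
        hreB _ hdB _ hb, addOn_map_inv hreB hdB]
      ring)
    x hx
  exact sub_eq_zero.mp key

/-- A chosen decomposition `g = d·x`, `d ∈ D`, `x ∈ G₁`. [folklore] -/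
noncomputable def dec (hm : 0 < m) (g : Gamma0 (p * m)) : Gamma0 (p * m) × Gamma0 (p * m) :=
  ⟨Classical.choose (exists_subD_mul_subG1 (p := p) hm g),
    Classical.choose (Classical.choose_spec (exists_subD_mul_subG1 (p := p) hm g))⟩

/-- Specification of `dec`. [folklore] -/
theorem dec_spec (hm : 0 < m) (g : Gamma0 (p * m)) :
    (dec (p := p) hm g).1 ∈ subD p m ∧ (dec (p := p) hm g).2 ∈ subG1 p m ∧ g = (dec (p := p) hm g).1 * (dec (p := p) hm g).2 :=
  Classical.choose_spec (Classical.choose_spec (exists_subD_mul_subG1 (p := p) hm g))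

/-- **The extended function** `w(g) = coshift φ ε (dec g).1 + W (dec g).2`. [folklore] -/
noncomputable def wfun (hm : 0 < m) (g : Gamma0 (p * m)) : K :=
  coshift φ ε (dec (p := p) hm g).1 + Wfun φ ε (dec (p := p) hm g).2

/-- `w` is additive on `Γ₀(pm)` and `w(d x) = coshift d + W x` for every `d ∈ D`, `x ∈ G₁`. [folklore] -/
theorem wfun_spec (hm : 0 < m) (hadd : IsAdd φ) (hinv : IsShiftEigenP p ε φ) (hP : φ (P2p p m) = φ (P1p p m)) :
    IsAdd (wfun φ ε hm) ∧ (∀ d ∈ subD p m, ∀ x ∈ subG1 p m, wfun φ ε hm (d * x) = coshift φ ε d + Wfun φ ε x) := by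
  obtain ⟨hW, hWA, -⟩ := Wfun_spec φ ε hadd hinv hP
  have hGn := subG1_normal (p := p) (m := m)
  have hcoA := coshift_add φ ε hadd (M := p * m)
  have h := glueExtend (N := subG1 p m) (D := subD p m) (w₁ := Wfun φ ε) (α := coshift φ ε)
    (fun d _ x hx => hGn.conj_mem x hx d) hW (Wfun_conj φ ε hadd hinv hP)
    (fun x hx y hy => hcoA x (mem_subD.mp hx).1 y (mem_subD.mp hy).1)
    (fun x hx hxG => (hWA x ⟨hxG, (ent_eq_zero_iff _ 0 1).mpr (mem_stabZero_iff.mp (mem_subD.mp hx).1)⟩).symm)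
    (dec (p := p) hm) (dec_spec hm)
  exact ⟨fun g g' => h.1 g g', h.2⟩

/-- **`w = coshift φ ε` on `A = {p ∣ b}`.** [folklore] -/
theorem wfun_of_mem_stabZero (hm : 0 < m) (hadd : IsAdd φ) (hinv : IsShiftEigenP p ε φ) (hP : φ (P2p p m) = φ (P1p p m))
    {y : Gamma0 (p * m)} (hy : y ∈ stabZero p (p * m)) : wfun φ ε hm y = coshift φ ε y := by
  have hpL := p_dvd_level p m
  obtain ⟨-, hval⟩ := wfun_spec φ ε hm hadd hinv hP
  obtain ⟨-, hWA, -⟩ := Wfun_spec φ ε hadd hinv hP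
  obtain ⟨d, x, hd, hx, rfl⟩ := exists_subD_mul_subG1 (p := p) hm y
  have hd0 := (mem_subD.mp hd).1
  have hx0 : x ∈ stabZero p (p * m) := by
    have : x = d⁻¹ * (d * x) := by group
    rw [this]; exact (stabZero p (p * m)).mul_mem ((stabZero p (p * m)).inv_mem hd0) hy
  have hxA : x ∈ subA1 p m := ⟨hx, (ent_eq_zero_iff _ 0 1).mpr (mem_stabZero_iff.mp hx0)⟩
  rw [hval d hd x hx, hWA x hxA, coshift_add φ ε hadd d hd0 x hx0]

/-- **`w = restr φ` on `B = Γ₀(p²m)`.** [folklore] -/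
theorem wfun_of_mem_subB (hm : 0 < m) (hadd : IsAdd φ) (hinv : IsShiftEigenP p ε φ) (hP : φ (P2p p m) = φ (P1p p m))
    {b : Gamma0 (p * m)} (hb : b ∈ subB p m) : wfun φ ε hm b = restr φ b := by
  obtain ⟨-, hval⟩ := wfun_spec φ ε hm hadd hinv hP
  obtain ⟨-, -, hWB⟩ := Wfun_spec φ ε hadd hinv hP
  obtain ⟨d, x, hd, hx, rfl⟩ := exists_subD_mul_subG1 (p := p) hm b
  obtain ⟨hd0, hdB⟩ := mem_subD.mp hd
  have hxB : x ∈ subB p m := by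
    have : x = d⁻¹ * (d * x) := by group
    rw [this]; exact (subB p m).mul_mem ((subB p m).inv_mem hdB) hb
  rw [hval d hd x hx, hWB x hxB hx, coshift_eq_restr_subB φ ε hinv d hd0 hdB, restr_add_subB φ hadd d hdB x hxB]

/-- **THE `K_{p,p}` STEP MODULO ONE EQUATION** (every prime `p`, every `m ≥ 1`, any `K`, any `ε`): an additive `φ : Γ₀(p²m) → K` with
`φ(a, pb; c, d) = ε φ(a, b; pc, d)` and `φ(P_{2/p}) = φ(P_{1/p})` is the restriction of an additive `ε`-eigenfunction of the `p`-shift on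
`Γ₀(pm)`. [new: p3's engine inside `G₁` + extension along the diagonal] -/
theorem descent (hm : 0 < m) (hadd : IsAdd φ) (hinv : IsShiftEigenP p ε φ) (hP : φ (P2p p m) = φ (P1p p m)) :
    ∃ w : Gamma0 (p * m) → K, IsAdd w ∧ IsShiftEigenP p ε w ∧ RestrictsFrom φ w := by
  refine ⟨wfun φ ε hm, (wfun_spec φ ε hm hadd hinv hP).1, ?_, ?_⟩
  · intro a b c d hdet hc
    rw [wfun_of_mem_stabZero φ ε hm hadd hinv hP (g0Of_mem_stabZero a b c d (by linear_combination hdet) hc),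
      coshift_g0Of φ ε a b c d _ hc hdet (dvd_p_mul' hc),
      wfun_of_mem_subB φ ε hm hadd hinv hP (g0Of_mem_subB a b (p * c) d hdet _ (dvd_p_mul' hc)),
      restr_g0Of φ a b (p * c) d hdet _ (dvd_p_mul' hc)]
  · intro a b c d hdet hcN hcM
    rw [wfun_of_mem_subB φ ε hm hadd hinv hP (g0Of_mem_subB a b c d hdet hcM hcN), restr_g0Of φ a b c d hdet hcM hcN]

end Extend

end PShiftEngine

end Summit.BirchSwinnertonDyer.BirchSwinnertonDyer.Theorems.ManinLocalTwoThree
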